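import Summits.BirchSwinnertonDyer.Rank1Residual.X11b.CastellaErratumClassNumber
import Summits.BirchSwinnertonDyer.Rank1Residual.X11b.LocalTorsionChainLocus
import HarnessLib

/-!
# X11b, route R1 — the DATA-LEVEL end form: `BSD(E,p)` from the census columns, the eight published facts, the displayed open input (A♭) and a field with `p ∤ h_K`

HONEST FRAMING (cell `b2b-bsdres`, run/shared/lean/b2b/bsd-rank1-residual/, verbatim in every
file): the goal of the cell is to DELETE the COMBINATION-SHAPED residual classes of the
Birch–Swinnerton-Dyer formula for ALL analytic-rank `≤ 1` elliptic curves over `ℚ` — "full BSD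
formula for every rank `≤ 1` curve in class `C`" assembled STRICTLY from published theorems — so
that the rank-`≤ 1` remainder becomes exactly the CONSTRUCTION-SHAPED classes, which are TYPED
(missing-input `Prop`s), NOT attempted. This is not "finishing BSD". Sub-cell
`b2b-bsdres-multr1-p1` (X11b, route R1); no claim beyond the stated class; X11b stays
CONSTRUCTION-SHAPED; nothing here changes a label; no named fact (theorems only; no `sorry`).

Composition of `CastellaErratumClassNumber.bsdp_of_display_hK` (gen 6: EIGHT published named facts
+ (A♭) + an erratum field with `p ∤ h_K`) with `LocalTorsionChainLocus.chainLocus_of_witnesses`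
(gen 6: `ChainLocus` from its prime witnesses alone when the reduction at `p` is non-split or
`p ∤ v_p(Δ_min)`): the hypotheses on the pair `(E, p)` are now EXACTLY the columns of the cell's
census (`census500k/census2.py`): `5 ≤ p`; multiplicative at `p`; `E[p]` irreducible; type at `p`
non-split OR `p ∤ v_p(Δ_min)`; an ODD prime `q ≠ p` of non-split multiplicative reduction with
`p ∤ v_q(Δ_min)`; a prime `ℓ ∉ {p, q}` of multiplicative reduction with `p ∤ v_ℓ(Δ_min)`;
`ord_{s=1} L(E,s) = 1` — plus the displayed inputs: the OPEN (A♭) and a field `K` (erratum field for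
`q` with `p ∤ h_K`; numerically exhibited for 26 450 of the 28 906 such pairs with `N < 2·10⁴`,
`|d_K| ≤ 4000`, HOME/b2b-bsdres-multr1-p1/hsupply/). CONDITIONAL; deletes nothing.

References: [Castella2018Erratum] Thm. 1.1, Thm. A′; [Castella2018] §5; [Castella2020JIMJ] §2.2 and
Thm. A (ii).
-/

noncomputable section

open scoped Classical

open WeierstrassCurve NumberField Literature.NumberTheory.EllipticCurves
  Literature.NumberTheory.EllipticCurves.ModularForms
  Literature.NumberTheory.EllipticCurves.Rank1Residual

namespace Summit.BirchSwinnertonDyer.Rank1Residual.X11b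

/-- **Route R1 at the data level.** For `W/ℚ` globally minimal elliptic with `ord_{s=1}L(E,s) = 1`
and a prime `p ≥ 5` of multiplicative reduction with `E[p]` irreducible, whose reduction is
non-split or has `p ∤ v_p(Δ_min)`; an ODD prime `q ≠ p` of non-split multiplicative reduction with
`p ∤ v_q(Δ_min)` and a further multiplicative `ℓ ∉ {p, q}` with `p ∤ v_ℓ(Δ_min)` (all decidable
from Cremona-type data); an erratum field `K` for `q` with `p ∤ h_K` (displayed supply); the EIGHT
published named facts `hGZ hGZK hSk hmod hCST hMaz hNS` (+ Friedberg–Hoffstein not needed here since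
`K` is given); and the OPEN input (A♭): `BSD(E,p)`. No `ChainLocus` predicate and no local-torsion
clause among the hypotheses (`chainLocus_of_witnesses`, `bsdp_of_display_hK`). CONDITIONAL on (A♭);
deletes nothing; X11b stays CONSTRUCTION-SHAPED.
[cite: Castella2018Erratum, Thm. 1.1 and Thm. A′ (p. 1), Remark (p. 2)] [cite: Castella2018, §5 (arXiv:1704.06608 p. 12)]
[cite: Castella2020JIMJ, Thm. A (ii) (arXiv:1410.6591 p. 3) and §2.2] -/
theorem bsdp_of_display_hK_of_witnesses
    (hGZ : GrossZagier1986_thm_I_7_3) (hGZK : rank_eq_analyticRank_of_analyticRank_le_one)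
    (hSk : Skinner2016.thmC_padicValRat_bsd_rank_zero) (hmod : exists_isNewformOf)
    (hCST : CaiShuTian2014.thm11_trivialChar)
    (hMaz : mazur_not_dvd_maninConstant_of_odd) (hNS : integral_neronScaling_of_isGloballyMinimal)
    (hA : ∀ (W : WeierstrassCurve ℚ) [W.IsElliptic] [W.IsGloballyMinimal] [NeZero (W.conductorNorm ℤ)]
        (p : ℕ) [Fact p.Prime] (q : ℕ) [Fact q.Prime] (K : Type) [Field K] [NumberField K]
        (Dt : ModularParametrizationData W (W.conductorNorm ℤ))
        (H : HeegnerDatum (W.conductorNorm ℤ) (NumberField.discr K)) (ι : K →+* ℂ)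
        (P : (W.baseChange K).toAffine.Point),
        ErratumHypotheses W p → W.analyticRank = 1 → q ≠ p → Mult W q →
        ¬ W.HasSplitMultiplicativeReductionAtPrime q → ¬ p ∣ padicValInt q W.minimalDiscriminantInt →
        IsErratumField W K q → ¬ (2 : ℤ) ∣ NumberField.discr K → ¬ p ∣ NumberField.classNumber K →
        WeierstrassCurve.Affine.Point.map ι.toRatAlgHom P = heegnerPointComplex Dt H →
        ¬ (p : ℤ) ∣ Dt.c → ¬ IsOfFinAddOrder P → Display53At W p K P)
    (W : WeierstrassCurve ℚ) [W.IsElliptic] [W.IsGloballyMinimal] (p : ℕ) [Fact p.Prime]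
    (hp : 5 ≤ p) (hmult : Mult W p) (hirr : Irr W p)
    (hloc : ¬ W.HasSplitMultiplicativeReductionAtPrime p ∨ ¬ p ∣ padicValInt p W.minimalDiscriminantInt)
    (hr : W.analyticRank = 1)
    {q : ℕ} [Fact q.Prime] {ℓ : ℕ} [Fact ℓ.Prime] (hq2 : q ≠ 2) (hqp : q ≠ p) (hℓp : ℓ ≠ p)
    (hℓq : ℓ ≠ q) (hmq : Mult W q) (hnsq : ¬ W.HasSplitMultiplicativeReductionAtPrime q)
    (hvq : ¬ p ∣ padicValInt q W.minimalDiscriminantInt)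
    (hmℓ : Mult W ℓ) (hvℓ : ¬ p ∣ padicValInt ℓ W.minimalDiscriminantInt)
    (K : Type) [Field K] [NumberField K] (hKf : IsErratumField W K q)
    (hhK : ¬ p ∣ NumberField.classNumber K) :
    BSDp W p :=
  bsdp_of_display_hK hGZ hGZK hSk hmod hCST hMaz hNS hA W p
    (chainLocus_of_witnesses W p hp hmult hirr hloc hqp hℓp hℓq hmq hnsq hvq hmℓ hvℓ) hr q hq2 hqp
    hmq hnsq hvq K hKf hhK

end Summit.BirchSwinnertonDyer.Rank1Residual.X11b

end
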